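import Summits.HodgeConjecture.HodgeConjecture.Theorems.Q8MonodromyBireflectionAssembly
import Literature.AlgebraicGeometry.HodgeTheory.MonodromyMumfordTateHeredity
import Literature.AlgebraicGeometry.HodgeTheory.HodgeGenericTypeStabilityOfGenericPoint
import Literature.AlgebraicGeometry.HodgeTheory.QbarFamilyLocalSystem
import HarnessLib

/-!
# Transport of the S5 clause along an intertwining isomorphism (base-point change for K1Q stub S5, skeleton v6)

Sub-problem `HodgeConjecture`, route `Summits/HodgeConjecture/HodgeConjecture/Theses/Q8SymplecticPowers.lean` (crux K1Q
`VeryGeneralQuaternionCommutatorsInHg`, stmt-HodgeConjecture-24190, stub S5 `stub_monodromyBireflectionQ`). Written by the prover seat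
`hodge-nonav-prover-Ax` (g18). HC ∕ HC_AV ∕ K1Q are NOT proved here.

S5-v6 asks its ∃-clause at EVERY point `s` of the base. The clause is a statement about the datum `(A, B, Qf, γ)` on `H²(X_s; ℚ)` base-changed
to `ℂ`; §1 (`clause_transport`) proves — by pure linear algebra — that it is carried along any `ℚ`-isomorphism `T : H ≃ H'` intertwining
`A, B` with `A', B'`, scaling the forms (`Q'(Tx, Ty) = c • Q(x, y)`, `c ≠ 0`) and conjugating `γ` to `T⁻¹ ≫ γ ≫ T`. In the family the
rational parallel transport along a path `s ⇝ t` is such a `T` (deck transformations commute with transport, the trace forms of two fibres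
agree up to the non-zero ratio of the chosen top-degree generators, and `Γ_t = T Γ_s T⁻¹`,
`Literature…MonodromyMumfordTateHeredity.conj_mem_ratMonodromyGroup_of_isRatTransport`), so the clause at ONE point of a path-connected
base gives it at all points.
-/

noncomputable section

set_option backward.isDefEq.respectTransparency false
set_option linter.dupNamespace false

open Module LinearMap
open scoped TensorProduct

namespace Summit.HodgeConjecture.HodgeConjecture.Theorems.Q8MonodromyBireflectionAssembly

/-! ### §1 Linear algebra: the clause is transported along an intertwining isomorphism -/

section Transport

variable {H H' : Type} [AddCommGroup H] [Module ℚ H] [AddCommGroup H'] [Module ℚ H']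

/-- Base change of an intertwining relation `T ∘ A = A' ∘ T`. [folklore] -/
theorem baseChange_apply_of_comm (T : H →ₗ[ℚ] H') (A : H →ₗ[ℚ] H) (A' : H' →ₗ[ℚ] H') (h : ∀ x, T (A x) = A' (T x))
    (u : ℂ ⊗[ℚ] H) : T.baseChange ℂ (A.baseChange ℂ u) = A'.baseChange ℂ (T.baseChange ℂ u) := by
  have hc : T ∘ₗ A = A' ∘ₗ T := LinearMap.ext h
  have := congrArg (fun f : H →ₗ[ℚ] H' => f.baseChange ℂ u) hc
  simpa only [LinearMap.baseChange_comp, LinearMap.comp_apply] using this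

/-- Base change of `T' ∘ T = id`. [folklore] -/
theorem baseChange_apply_of_comp_eq_id (T : H →ₗ[ℚ] H') (T' : H' →ₗ[ℚ] H) (h : ∀ x, T' (T x) = x) (u : ℂ ⊗[ℚ] H) :
    T'.baseChange ℂ (T.baseChange ℂ u) = u := by
  have hc : T' ∘ₗ T = LinearMap.id := LinearMap.ext h
  have := congrArg (fun f : H →ₗ[ℚ] H => f.baseChange ℂ u) hc
  simpa only [LinearMap.baseChange_comp, LinearMap.comp_apply, LinearMap.baseChange_id, LinearMap.id_apply] using this

/-- `T_ℂ` maps `E_ℂ` into `E'_ℂ` when `T` maps `E` into `E'`. [folklore] -/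
theorem baseChange_mem_baseChange_of_mapsTo (T : H →ₗ[ℚ] H') (E : Submodule ℚ H) (E' : Submodule ℚ H') (h : ∀ x ∈ E, T x ∈ E')
    {u : ℂ ⊗[ℚ] H} (hu : u ∈ E.baseChange ℂ) : T.baseChange ℂ u ∈ E'.baseChange ℂ := by
  rw [Submodule.baseChange_eq_span] at hu
  refine Submodule.span_induction (p := fun u _ => T.baseChange ℂ u ∈ E'.baseChange ℂ) ?_ ?_ ?_ ?_ hu
  · rintro _ ⟨x, hx, rfl⟩
    simp only [TensorProduct.mk_apply, LinearMap.baseChange_tmul]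
    exact Submodule.tmul_mem_baseChange_of_mem 1 (h x hx)
  · simp only [map_zero]; exact Submodule.zero_mem _
  · intro x y _ _ hx hy; rw [map_add]; exact Submodule.add_mem _ hx hy
  · intro a x _ hx; rw [map_smul]; exact Submodule.smul_mem _ a hx

/-- Base change of a scaled isometry relation `Q'(Tx, Ty) = c • Q(x, y)`. [folklore] -/
theorem bilin_baseChange_apply_of_eq (T : H →ₗ[ℚ] H') (Q : LinearMap.BilinForm ℚ H) (Q' : LinearMap.BilinForm ℚ H') (c : ℚ)
    (h : ∀ x y, Q' (T x) (T y) = c • Q x y) (u v : ℂ ⊗[ℚ] H) :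
    (Q'.baseChange ℂ) (T.baseChange ℂ u) (T.baseChange ℂ v) = (c : ℂ) * (Q.baseChange ℂ) u v := by
  induction u using TensorProduct.induction_on generalizing v with
  | zero => simp
  | add u₁ u₂ h₁ h₂ => rw [map_add, map_add, LinearMap.add_apply, h₁, h₂, map_add, LinearMap.add_apply, mul_add]
  | tmul a x =>
    induction v using TensorProduct.induction_on with
    | zero => simp
    | add v₁ v₂ h₁ h₂ => rw [map_add, map_add, h₁, h₂, map_add, mul_add]
    | tmul b y =>
      simp only [LinearMap.baseChange_tmul, LinearMap.BilinForm.baseChange_tmul, h x y, smul_eq_mul, Algebra.smul_def, map_mul,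
        eq_ratCast]
      ring

/-- **The S5 clause is transported along an intertwining isomorphism.** `T : H ≃ H'` with `T A = A' T`, `T B = B' T`,
`Q'(Tx, Ty) = c • Q(x, y)` (`c ≠ 0`); if the clause holds for `(A, B, Q, γ)` then it holds for `(A', B', Q', T⁻¹ ≫ γ ≫ T)`.
[cite: VoisinHodgeII2003, §3.1.2] -/
theorem clause_transport (A B : H →ₗ[ℚ] H) (Q : LinearMap.BilinForm ℚ H) (γ : H ≃ₗ[ℚ] H) (A' B' : H' →ₗ[ℚ] H')
    (Q' : LinearMap.BilinForm ℚ H') (T : H ≃ₗ[ℚ] H') (hA : ∀ x, T (A x) = A' (T x)) (hB : ∀ x, T (B x) = B' (T x)) {c : ℚ}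
    (hc : c ≠ 0) (hQ : ∀ x y, Q' (T x) (T y) = c • Q x y)
    (h : ∃ ℓp ℓm : ℂ ⊗[ℚ] H,
      ℓp ∈ (Module.End.eigenspace (A ^ 2) (-1)).baseChange ℂ ∧ ℓm ∈ (Module.End.eigenspace (A ^ 2) (-1)).baseChange ℂ ∧
      A.baseChange ℂ ℓp = Complex.I • ℓp ∧ A.baseChange ℂ ℓm = Complex.I • ℓm ∧ (Q.baseChange ℂ) ℓp (B.baseChange ℂ ℓm) ≠ 0 ∧
      (γ.toLinearMap.baseChange ℂ) ℓp = Complex.I • ℓp ∧ (γ.toLinearMap.baseChange ℂ) ℓm = (-Complex.I) • ℓm ∧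
      ∀ x ∈ (Module.End.eigenspace (A ^ 2) (-1)).baseChange ℂ, A.baseChange ℂ x = Complex.I • x →
        (Q.baseChange ℂ) x (B.baseChange ℂ ℓp) = 0 → (Q.baseChange ℂ) x (B.baseChange ℂ ℓm) = 0 → (γ.toLinearMap.baseChange ℂ) x = x) :
    ∃ ℓp ℓm : ℂ ⊗[ℚ] H',
      ℓp ∈ (Module.End.eigenspace (A' ^ 2) (-1)).baseChange ℂ ∧ ℓm ∈ (Module.End.eigenspace (A' ^ 2) (-1)).baseChange ℂ ∧
      A'.baseChange ℂ ℓp = Complex.I • ℓp ∧ A'.baseChange ℂ ℓm = Complex.I • ℓm ∧ (Q'.baseChange ℂ) ℓp (B'.baseChange ℂ ℓm) ≠ 0 ∧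
      ((T.symm.trans (γ.trans T)).toLinearMap.baseChange ℂ) ℓp = Complex.I • ℓp ∧
      ((T.symm.trans (γ.trans T)).toLinearMap.baseChange ℂ) ℓm = (-Complex.I) • ℓm ∧
      ∀ x ∈ (Module.End.eigenspace (A' ^ 2) (-1)).baseChange ℂ, A'.baseChange ℂ x = Complex.I • x →
        (Q'.baseChange ℂ) x (B'.baseChange ℂ ℓp) = 0 → (Q'.baseChange ℂ) x (B'.baseChange ℂ ℓm) = 0 →
        ((T.symm.trans (γ.trans T)).toLinearMap.baseChange ℂ) x = x := by
  obtain ⟨ℓp, ℓm, hp, hm, hAp, hAm, hQ0, hγp, hγm, hall⟩ := h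
  -- notation
  let TL := (T : H →ₗ[ℚ] H').baseChange ℂ
  let TL' := (T.symm : H' →ₗ[ℚ] H).baseChange ℂ
  have hTT' : ∀ u, TL' (TL u) = u := baseChange_apply_of_comp_eq_id _ _ (fun x => T.symm_apply_apply x)
  have hT'T : ∀ u, TL (TL' u) = u := baseChange_apply_of_comp_eq_id _ _ (fun x => T.apply_symm_apply x)
  have hTinj : Function.Injective TL := fun u v huv => by rw [← hTT' u, ← hTT' v]; exact congrArg TL' huv
  have hTA : ∀ u, TL (A.baseChange ℂ u) = A'.baseChange ℂ (TL u) := baseChange_apply_of_comm _ _ _ hA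
  have hTB : ∀ u, TL (B.baseChange ℂ u) = B'.baseChange ℂ (TL u) := baseChange_apply_of_comm _ _ _ hB
  have hA2 : ∀ x, T ((A ^ 2) x) = (A' ^ 2) (T x) := fun x => by
    simp only [pow_two, Module.End.mul_apply, hA]
  have hA2' : ∀ y, T.symm ((A' ^ 2) y) = (A ^ 2) (T.symm y) := fun y => by
    apply T.injective; rw [hA2, T.apply_symm_apply, T.apply_symm_apply]
  have hE : ∀ x ∈ Module.End.eigenspace (A ^ 2) (-1 : ℚ), T x ∈ Module.End.eigenspace (A' ^ 2) (-1 : ℚ) := fun x hx => by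
    rw [Module.End.mem_eigenspace_iff] at hx ⊢
    rw [← hA2, hx, map_smul]
  have hE' : ∀ y ∈ Module.End.eigenspace (A' ^ 2) (-1 : ℚ), T.symm y ∈ Module.End.eigenspace (A ^ 2) (-1 : ℚ) := fun y hy => by
    rw [Module.End.mem_eigenspace_iff] at hy ⊢
    rw [← hA2', hy, map_smul]
  have hTQ : ∀ u v, (Q'.baseChange ℂ) (TL u) (TL v) = (c : ℂ) * (Q.baseChange ℂ) u v := bilin_baseChange_apply_of_eq _ Q Q' c hQ
  -- the conjugated automorphism, base-changed
  have hγ' : ∀ u, ((T.symm.trans (γ.trans T)).toLinearMap.baseChange ℂ) u = TL ((γ.toLinearMap.baseChange ℂ) (TL' u)) := fun u => by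
    have hc : (T.symm.trans (γ.trans T)).toLinearMap = (T : H →ₗ[ℚ] H') ∘ₗ γ.toLinearMap ∘ₗ (T.symm : H' →ₗ[ℚ] H) :=
      LinearMap.ext fun x => rfl
    rw [hc, LinearMap.baseChange_comp, LinearMap.baseChange_comp]
    rfl
  have hcC : (c : ℂ) ≠ 0 := by exact_mod_cast hc
  refine ⟨TL ℓp, TL ℓm, baseChange_mem_baseChange_of_mapsTo _ _ _ hE hp, baseChange_mem_baseChange_of_mapsTo _ _ _ hE hm,
    by rw [← hTA, hAp, map_smul], by rw [← hTA, hAm, map_smul], ?_, ?_, ?_, ?_⟩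
  · rw [← hTB, hTQ]; exact mul_ne_zero hcC hQ0
  · rw [hγ', hTT', hγp, map_smul]
  · rw [hγ', hTT', hγm, map_smul]
  · intro x hx hAx hQp hQm
    have hx' : TL' x ∈ (Module.End.eigenspace (A ^ 2) (-1 : ℚ)).baseChange ℂ := baseChange_mem_baseChange_of_mapsTo _ _ _ hE' hx
    have hAx' : A.baseChange ℂ (TL' x) = Complex.I • TL' x := by
      apply hTinj
      rw [hTA, hT'T, hAx, map_smul, hT'T]
    have hQp' : (Q.baseChange ℂ) (TL' x) (B.baseChange ℂ ℓp) = 0 := by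
      have h1 := hTQ (TL' x) (B.baseChange ℂ ℓp)
      rw [hT'T, hTB] at h1
      exact (mul_eq_zero.mp (h1.symm.trans hQp)).resolve_left hcC
    have hQm' : (Q.baseChange ℂ) (TL' x) (B.baseChange ℂ ℓm) = 0 := by
      have h1 := hTQ (TL' x) (B.baseChange ℂ ℓm)
      rw [hT'T, hTB] at h1
      exact (mul_eq_zero.mp (h1.symm.trans hQm)).resolve_left hcC
    rw [hγ', hall (TL' x) hx' hAx' hQp' hQm', hT'T]

end Transport


/-! ### §2 The family: the clause at one point of the base gives it at every path-joined point -/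

section Family

open CategoryTheory AlgebraicGeometry
open Literature.AlgebraicTopology.SingularHomology Literature.AlgebraicGeometry Literature.AlgebraicGeometry.Motives
open Literature.AlgebraicGeometry.HodgeTheory Literature.AlgebraicGeometry.HodgeTheory.BettiUniverse

/-- Two linear functionals on a line, both injective, are non-zero multiples of each other. [folklore] -/
theorem exists_eq_mul_of_finrank_eq_one {V : Type} [AddCommGroup V] [Module ℚ V] (hV : finrank ℚ V = 1) (f g : V →ₗ[ℚ] ℚ)
    (hf : Function.Injective f) (hg : Function.Injective g) : ∃ c : ℚ, c ≠ 0 ∧ ∀ v, f v = c * g v := by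
  haveI : Module.Finite ℚ V := Module.finite_of_finrank_eq_succ hV
  obtain ⟨v₀, hv₀⟩ : ∃ v₀ : V, v₀ ≠ 0 := Module.finrank_pos_iff_exists_ne_zero.mp (by rw [hV]; exact one_pos)
  have hg0 : g v₀ ≠ 0 := fun h0 => hv₀ (hg (by rw [h0, map_zero]))
  have hf0 : f v₀ ≠ 0 := fun h0 => hv₀ (hf (by rw [h0, map_zero]))
  refine ⟨f v₀ / g v₀, div_ne_zero hf0 hg0, fun v => ?_⟩
  obtain ⟨q, rfl⟩ := (finrank_eq_one_iff_of_nonzero' v₀ hv₀).1 hV v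
  rw [map_smul, map_smul, smul_eq_mul, smul_eq_mul]
  field_simp

variable {𝒳 S : SchemeOver ℂ} (π : 𝒳 ⟶ S) {τ : 𝒳 ⟶ 𝒳} (hτπ : τ ≫ π = π)

/-- A rational transport along a path intertwines the deck pull-backs `τ_s^*`, `τ_t^*`. [cite: VoisinHodgeII2003, §3.1.2] -/
theorem ratTransport_pull_fiberOverEnd (k : ℕ) (hU : IsCohomologicallyLocallyTrivialOn π (Set.univ : Set (ComplexPoints S)))
    {s t : (Set.univ : Set (ComplexPoints S))} {δ : Path.Homotopic.Quotient s t}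
    {T : bettiCohomology (fiberOver π s.1) k ≃ₗ[ℚ] bettiCohomology (fiberOver π t.1) k} (hT : IsRatTransport π k hU δ T)
    (x : bettiCohomology (fiberOver π s.1) k) :
    T (pull (fiberOverEnd π τ hτπ s.1) k x) = pull (fiberOverEnd π τ hτπ t.1) k (T x) := by
  apply ofRatClass_injective
  rw [hT, ofRatClass_pull, ofRatClass_pull, hT]
  exact transportFun_map_fiberHom π k hU τ hτπ (fun t => fiberOverEnd π τ hτπ t) (fun t => fiberOverEnd_comp_fiberι π τ hτπ t) δ _

/-- Rational transports in degrees `2` and `2 + 2` are compatible with the cup product. [cite: VoisinHodgeII2003, §3.1.2] -/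
theorem ratTransport_cup (hU : IsCohomologicallyLocallyTrivialOn π (Set.univ : Set (ComplexPoints S)))
    {s t : (Set.univ : Set (ComplexPoints S))} {δ : Path.Homotopic.Quotient s t}
    {T : bettiCohomology (fiberOver π s.1) 2 ≃ₗ[ℚ] bettiCohomology (fiberOver π t.1) 2} (hT : IsRatTransport π 2 hU δ T)
    {T₄ : bettiCohomology (fiberOver π s.1) (2 + 2) ≃ₗ[ℚ] bettiCohomology (fiberOver π t.1) (2 + 2)}
    (hT₄ : IsRatTransport π (2 + 2) hU δ T₄) (x y : bettiCohomology (fiberOver π s.1) 2) :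
    cup (fiberOver π t.1) 2 2 (T x) (T y) = T₄ (cup (fiberOver π s.1) 2 2 x y) := by
  apply ofRatClass_injective
  change ofRatClass _ (2 + 2) (bettiCup rfl (T x) (T y)) = ofRatClass _ (2 + 2) (T₄ (bettiCup rfl x y))
  rw [ofRatClass_bettiCup, hT, hT, hT₄, ofRatClass_bettiCup, transportFun_cupProduct]

/-- **The trace forms of two path-joined fibres agree up to a non-zero scalar under rational transport**:
`tr_t(Tx ∪ Ty) = c • tr_s(x ∪ y)` with `c ≠ 0` (both `tr_t ∘ T₄` and `tr_s` are injective functionals on the line `H⁴(X_s; ℚ)`).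
[cite: VoisinHodgeII2003, §3.1.2] [cite: HatcherAT2002, §3.3 Cor. 3.37] -/
theorem exists_tr_cup_ratTransport (hπ : IsSmoothProjectiveFamily π 2)
    (hU : IsCohomologicallyLocallyTrivialOn π (Set.univ : Set (ComplexPoints S)))
    {s t : (Set.univ : Set (ComplexPoints S))} {δ : Path.Homotopic.Quotient s t}
    {T : bettiCohomology (fiberOver π s.1) 2 ≃ₗ[ℚ] bettiCohomology (fiberOver π t.1) 2} (hT : IsRatTransport π 2 hU δ T)
    {T₄ : bettiCohomology (fiberOver π s.1) (2 + 2) ≃ₗ[ℚ] bettiCohomology (fiberOver π t.1) (2 + 2)}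
    (hT₄ : IsRatTransport π (2 + 2) hU δ T₄) :
    ∃ c : ℚ, c ≠ 0 ∧ ∀ x y : bettiCohomology (fiberOver π s.1) 2,
      tr (hπ.isSmoothProjective t.1) (2 + 2) (cup (fiberOver π t.1) 2 2 (T x) (T y)) =
        c • tr (hπ.isSmoothProjective s.1) (2 + 2) (cup (fiberOver π s.1) 2 2 x y) := by
  have h1 : finrank ℚ (bettiCohomology (fiberOver π s.1) (2 + 2)) = 1 := finrank_bettiCohomology_top (n := 2) (hπ.isSmoothProjective s.1)
  obtain ⟨c, hc, hcf⟩ := exists_eq_mul_of_finrank_eq_one h1 (tr (hπ.isSmoothProjective t.1) (2 + 2) ∘ₗ T₄.toLinearMap)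
    (tr (hπ.isSmoothProjective s.1) (2 + 2)) ((tr_top_injective (hπ.isSmoothProjective t.1)).comp T₄.injective)
    (tr_top_injective (hπ.isSmoothProjective s.1))
  refine ⟨c, hc, fun x y => ?_⟩
  rw [ratTransport_cup π hU hT hT₄, smul_eq_mul, ← hcf, LinearMap.comp_apply]
  rfl

/-- **Base-point change for the S5 clause.** For a smooth projective family of surfaces over a quasi-projective base smooth of some pure
dimension, with a deck pair `τ, j` over the base: if the ∃-clause of `stub_monodromyBireflectionQ` (v6) holds at `s`, it holds at every
point `t` joined to `s` by a path (rational transport `T`: `γ ↦ T⁻¹ ≫ γ ≫ T ∈ Γ_t`, `ℓ ↦ T_ℂ ℓ`). [cite: VoisinHodgeII2003, §3.1.2] -/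
theorem clause_transport_family (hπ : IsSmoothProjectiveFamily π 2) (hS : IsQuasiProjectiveOver S) {d : ℕ}
    [SmoothOfRelativeDimension d S.hom] {j : 𝒳 ⟶ 𝒳} (hjπ : j ≫ π = π)
    (hU : IsCohomologicallyLocallyTrivialOn π (Set.univ : Set (ComplexPoints S))) {s t : ComplexPoints S}
    (δ : Path.Homotopic.Quotient (⟨s, Set.mem_univ s⟩ : (Set.univ : Set (ComplexPoints S))) ⟨t, Set.mem_univ t⟩)
    (hs : let Xs := fiberOver π s
      let hXs : IsSmoothProjective 2 Xs := hπ.isSmoothProjective s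
      let A : bettiCohomology Xs 2 →ₗ[ℚ] bettiCohomology Xs 2 := pull (fiberOverEnd π τ hτπ s) 2
      let B : bettiCohomology Xs 2 →ₗ[ℚ] bettiCohomology Xs 2 := pull (fiberOverEnd π j hjπ s) 2
      let Qf : LinearMap.BilinForm ℚ (bettiCohomology Xs 2) := LinearMap.compr₂ (cup Xs 2 2) (tr hXs (2 + 2))
      let Γ := ratMonodromyGroup π 2 hU ⟨s, Set.mem_univ s⟩
      ∃ γ ∈ Γ, ∃ ℓp ℓm : TensorProduct ℚ ℂ (bettiCohomology Xs 2),
        ℓp ∈ (Module.End.eigenspace (A ^ 2) (-1)).baseChange ℂ ∧ ℓm ∈ (Module.End.eigenspace (A ^ 2) (-1)).baseChange ℂ ∧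
        A.baseChange ℂ ℓp = Complex.I • ℓp ∧ A.baseChange ℂ ℓm = Complex.I • ℓm ∧ (Qf.baseChange ℂ) ℓp (B.baseChange ℂ ℓm) ≠ 0 ∧
        (γ.toLinearMap.baseChange ℂ) ℓp = Complex.I • ℓp ∧ (γ.toLinearMap.baseChange ℂ) ℓm = (-Complex.I) • ℓm ∧
        ∀ x ∈ (Module.End.eigenspace (A ^ 2) (-1)).baseChange ℂ, A.baseChange ℂ x = Complex.I • x →
          (Qf.baseChange ℂ) x (B.baseChange ℂ ℓp) = 0 → (Qf.baseChange ℂ) x (B.baseChange ℂ ℓm) = 0 →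
          (γ.toLinearMap.baseChange ℂ) x = x) :
    let Xs := fiberOver π t
    let hXs : IsSmoothProjective 2 Xs := hπ.isSmoothProjective t
    let A : bettiCohomology Xs 2 →ₗ[ℚ] bettiCohomology Xs 2 := pull (fiberOverEnd π τ hτπ t) 2
    let B : bettiCohomology Xs 2 →ₗ[ℚ] bettiCohomology Xs 2 := pull (fiberOverEnd π j hjπ t) 2
    let Qf : LinearMap.BilinForm ℚ (bettiCohomology Xs 2) := LinearMap.compr₂ (cup Xs 2 2) (tr hXs (2 + 2))
    let Γ := ratMonodromyGroup π 2 hU ⟨t, Set.mem_univ t⟩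
    ∃ γ ∈ Γ, ∃ ℓp ℓm : TensorProduct ℚ ℂ (bettiCohomology Xs 2),
      ℓp ∈ (Module.End.eigenspace (A ^ 2) (-1)).baseChange ℂ ∧ ℓm ∈ (Module.End.eigenspace (A ^ 2) (-1)).baseChange ℂ ∧
      A.baseChange ℂ ℓp = Complex.I • ℓp ∧ A.baseChange ℂ ℓm = Complex.I • ℓm ∧ (Qf.baseChange ℂ) ℓp (B.baseChange ℂ ℓm) ≠ 0 ∧
      (γ.toLinearMap.baseChange ℂ) ℓp = Complex.I • ℓp ∧ (γ.toLinearMap.baseChange ℂ) ℓm = (-Complex.I) • ℓm ∧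
      ∀ x ∈ (Module.End.eigenspace (A ^ 2) (-1)).baseChange ℂ, A.baseChange ℂ x = Complex.I • x →
        (Qf.baseChange ℂ) x (B.baseChange ℂ ℓp) = 0 → (Qf.baseChange ℂ) x (B.baseChange ℂ ℓm) = 0 → (γ.toLinearMap.baseChange ℂ) x = x := by
  intro Xs hXs A B Qf Γ
  obtain ⟨γ, hγ, hcl⟩ := hs
  -- rational transports in degrees `2` and `2 + 2` along `δ`
  have hrat : ∀ (k : ℕ) (s t : (Set.univ : Set (ComplexPoints S))) (γ : Path.Homotopic.Quotient s t)
      (α : complexBetti (fiberOver π s.1) k), IsRationalClass α → IsRationalClass (transportFun π k hU γ α) :=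
    fun k s t γ α hα => isRationalClass_transportFun_of_isSmoothProjectiveFamily π k d hπ hS γ hα
  obtain ⟨T, hT⟩ := exists_ratTransport π 2 hU (hrat 2) δ
  obtain ⟨T₄, hT₄⟩ := exists_ratTransport π (2 + 2) hU (hrat (2 + 2)) δ
  obtain ⟨c, hc, hcQ⟩ := exists_tr_cup_ratTransport π hπ hU hT hT₄
  refine ⟨T.symm.trans (γ.trans T), conj_mem_ratMonodromyGroup_of_isRatTransport π 2 hU hT hγ, ?_⟩
  have hA₀ := ratTransport_pull_fiberOverEnd π hτπ 2 hU hT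
  have hA : ∀ x, T (pull (fiberOverEnd π τ hτπ s) 2 x) = A (T x) := fun x => by
    have h1 := hA₀ x
    exact h1
  have hB₀ := ratTransport_pull_fiberOverEnd π hjπ 2 hU hT
  have hB : ∀ x, T (pull (fiberOverEnd π j hjπ s) 2 x) = B (T x) := fun x => by
    have h1 := hB₀ x
    exact h1
  have hQ : ∀ x y, Qf (T x) (T y) =
      c • (LinearMap.compr₂ (cup (fiberOver π s) 2 2) (tr (hπ.isSmoothProjective s) (2 + 2)) : LinearMap.BilinForm ℚ _) x y :=
    fun x y => by
      have h1 := hcQ x y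
      exact h1
  have key := clause_transport (H' := bettiCohomology Xs 2) (pull (fiberOverEnd π τ hτπ s) 2) (pull (fiberOverEnd π j hjπ s) 2)
    (LinearMap.compr₂ (cup (fiberOver π s) 2 2) (tr (hπ.isSmoothProjective s) (2 + 2)) : LinearMap.BilinForm ℚ _) γ A B Qf T
    hA hB hc hQ hcl
  exact key

/-- **The clause at one point of a path-connected base gives it everywhere.** [cite: VoisinHodgeII2003, §3.1.2] -/
theorem clause_transport_family_of_pathConnected [PathConnectedSpace (ComplexPoints S)] (hπ : IsSmoothProjectiveFamily π 2)
    (hS : IsQuasiProjectiveOver S) {d : ℕ} [SmoothOfRelativeDimension d S.hom] {j : 𝒳 ⟶ 𝒳} (hjπ : j ≫ π = π)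
    (hU : IsCohomologicallyLocallyTrivialOn π (Set.univ : Set (ComplexPoints S))) {s : ComplexPoints S}
    (hs : let Xs := fiberOver π s
      let hXs : IsSmoothProjective 2 Xs := hπ.isSmoothProjective s
      let A : bettiCohomology Xs 2 →ₗ[ℚ] bettiCohomology Xs 2 := pull (fiberOverEnd π τ hτπ s) 2
      let B : bettiCohomology Xs 2 →ₗ[ℚ] bettiCohomology Xs 2 := pull (fiberOverEnd π j hjπ s) 2
      let Qf : LinearMap.BilinForm ℚ (bettiCohomology Xs 2) := LinearMap.compr₂ (cup Xs 2 2) (tr hXs (2 + 2))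
      let Γ := ratMonodromyGroup π 2 hU ⟨s, Set.mem_univ s⟩
      ∃ γ ∈ Γ, ∃ ℓp ℓm : TensorProduct ℚ ℂ (bettiCohomology Xs 2),
        ℓp ∈ (Module.End.eigenspace (A ^ 2) (-1)).baseChange ℂ ∧ ℓm ∈ (Module.End.eigenspace (A ^ 2) (-1)).baseChange ℂ ∧
        A.baseChange ℂ ℓp = Complex.I • ℓp ∧ A.baseChange ℂ ℓm = Complex.I • ℓm ∧ (Qf.baseChange ℂ) ℓp (B.baseChange ℂ ℓm) ≠ 0 ∧
        (γ.toLinearMap.baseChange ℂ) ℓp = Complex.I • ℓp ∧ (γ.toLinearMap.baseChange ℂ) ℓm = (-Complex.I) • ℓm ∧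
        ∀ x ∈ (Module.End.eigenspace (A ^ 2) (-1)).baseChange ℂ, A.baseChange ℂ x = Complex.I • x →
          (Qf.baseChange ℂ) x (B.baseChange ℂ ℓp) = 0 → (Qf.baseChange ℂ) x (B.baseChange ℂ ℓm) = 0 →
          (γ.toLinearMap.baseChange ℂ) x = x) (t : ComplexPoints S) :
    let Xs := fiberOver π t
    let hXs : IsSmoothProjective 2 Xs := hπ.isSmoothProjective t
    let A : bettiCohomology Xs 2 →ₗ[ℚ] bettiCohomology Xs 2 := pull (fiberOverEnd π τ hτπ t) 2
    let B : bettiCohomology Xs 2 →ₗ[ℚ] bettiCohomology Xs 2 := pull (fiberOverEnd π j hjπ t) 2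
    let Qf : LinearMap.BilinForm ℚ (bettiCohomology Xs 2) := LinearMap.compr₂ (cup Xs 2 2) (tr hXs (2 + 2))
    let Γ := ratMonodromyGroup π 2 hU ⟨t, Set.mem_univ t⟩
    ∃ γ ∈ Γ, ∃ ℓp ℓm : TensorProduct ℚ ℂ (bettiCohomology Xs 2),
      ℓp ∈ (Module.End.eigenspace (A ^ 2) (-1)).baseChange ℂ ∧ ℓm ∈ (Module.End.eigenspace (A ^ 2) (-1)).baseChange ℂ ∧
      A.baseChange ℂ ℓp = Complex.I • ℓp ∧ A.baseChange ℂ ℓm = Complex.I • ℓm ∧ (Qf.baseChange ℂ) ℓp (B.baseChange ℂ ℓm) ≠ 0 ∧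
      (γ.toLinearMap.baseChange ℂ) ℓp = Complex.I • ℓp ∧ (γ.toLinearMap.baseChange ℂ) ℓm = (-Complex.I) • ℓm ∧
      ∀ x ∈ (Module.End.eigenspace (A ^ 2) (-1)).baseChange ℂ, A.baseChange ℂ x = Complex.I • x →
        (Qf.baseChange ℂ) x (B.baseChange ℂ ℓp) = 0 → (Qf.baseChange ℂ) x (B.baseChange ℂ ℓm) = 0 → (γ.toLinearMap.baseChange ℂ) x = x := by
  have hJ : JoinedIn (Set.univ : Set (ComplexPoints S)) s t :=
    isPathConnected_univ.joinedIn s (Set.mem_univ s) t (Set.mem_univ t)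
  obtain ⟨p⟩ := hJ.joined_subtype
  exact clause_transport_family π hτπ hπ hS (d := d) hjπ hU ⟦p⟧ hs

end Family

end Summit.HodgeConjecture.HodgeConjecture.Theorems.Q8MonodromyBireflectionAssembly

end
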